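import Literature.AlgebraicGeometry.AbelianSchemes.TupleRelCancel                    -- FILE 1∕2: `exists_tupleRel_baseChange_baseChange_of_comp_eq`, `exists_tupleRel_baseChange_of_tupleRel_comp`
import Literature.AlgebraicGeometry.Limits.LocalizationOpenDescent                   -- ★ `LocApprox.leg`, `baseDiagram`, `hom_eq_of_mono_hom`
import Literature.AlgebraicGeometry.Motives.IntegralModelOfGlobalModel               -- ★ `IntegralModel.localise`, `towerLeftIso`, `specMap_algebraMap_comp`
import Literature.RingTheory.DedekindDomain.UnitsAtCofinitelyManyPrimes              -- ★ `eventually_isUnit_algebraMap_valuationSubringAtPrime`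
import HarnessLib

/-!
# A PEL tuple over a stage `P ×_A Spec A[1/t]` RESTRICTS to `P ×_A Spec T` for every `A`-algebra `T` with `t ∈ Tˣ`,
# with its generic reading (the five clauses of MFK Def. 7.2 along `𝟙`, `𝒪`-equivariantly)

Topic `AlgebraicGeometry/AbelianSchemes`; namespace `Literature.AlgebraicGeometry.AbelianSchemes` (§2, §4; `….AbelianSchemeOver` §3; one
dot-notation extension `Motives.IntegralModel.genericIso'_inv_left_comp_fst`).  THEOREMS ONLY (no definition, no named fact, no instance, no
notation, no `sorry`).  Cell hodgecm-mathlib (D-0151), P6 «MOD programme», FILE 2∕2 of organ (GS-2-core) «STAGE TUPLE ⇒ EVERY `A`-ALGEBRA `T` WITH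
`t ∈ Tˣ`, WITH ITS GENERIC READING» (LEAD F0P6-plan (g3) 2026-09-02T01:09:11Z «=», road-independent; census
`F0/P6/B-p18/g38/CENSUS-GS1-OneCommonStage.v1` §1; FILE 1∕2 = ★ `AbelianSchemes/TupleRelCancel`; consumer: the P-line `Lines/F0_P6a_PELInputs.lean`
socket `stub_SPREAD`, whose carrier `PELSpreadAt` wants the tuple `univ act dual pol lvl` over `(𝓜.localise w).total = 𝓜.total ⊗_{𝓞 F} 𝒪_{F,(w)}`
together with its identification over the generic fibre, field `gen_iso`, through ★ `exists_tupleIsoVia_of_tupleRel`).  HC_CM is proved only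
modulo the printed citations until rung 0 closes; nothing here is about HC.

THE MATHEMATICS ([EGAIV3] 8.8.2.5: data spread to a dense open `D(t) ⊆ Spec A` are read over every `A`-algebra `T` in which `t` is invertible,
`Spec T → Spec A` factoring — uniquely, `D(t) ↪ Spec A` being a monomorphism — through `D(t)`; [MumfordFogartyKirwan1994] Ch. 7 §2 Def. 7.2:
pull-back of PEL tuples «in the obvious way»; [GortzWedhorn2020] (4.7)–(4.8): transitivity of fibre products).  §2: for a multiplicative subset
`S ⊆ A`, an index `t ∈ S` and an `A`-algebra `T` with `t ∈ Tˣ` there is an `A`-morphism `τ : Spec T → Spec A[1∕t] = D(t)` (Mathlib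
`IsLocalization.Away.lift`), and for every `A`-morphism `κ : Spec K → Spec T` (`K = A_S`, e.g. `Frac A`) `κ ≫ τ` IS the cone leg `Spec K → D(t)`
(★ `hom_eq_of_mono_hom`), whence `(P ◁ κ) ≫ (P ◁ τ) = P ◁ leg` on `P ×_A −`.  §3 THE HEADS.  Let a PEL tuple `(𝒜, ι, (Â, 𝒫), λ, φ)` be given over the
stage `P ⊗ D(t)`; the `T`-TUPLE is its base change along `P ◁ τ : P ⊗ Spec T → P ⊗ D(t)`.  (a) Its base change to the generic fibre `P ⊗ Spec K`
along `P ◁ κ` and the base change of the stage tuple along the cone map `P ◁ leg` satisfy the five clauses of MFK's «isomorphism of triples» along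
`𝟙 (P ⊗ Spec K)`, `𝒪`-equivariantly, in both directions (FILE 1 §1 under `(P ◁ κ) ≫ (P ◁ τ) = P ◁ leg`) — so every generic identification of the
stage tuple transfers to the `T`-tuple by ★ `tupleRel_comp_id_id`.  (b) In the general-base-map currency: a tuple over any `Z` that is a six-clause
pull-back of the stage tuple along `m₀ ≫ (P ◁ τ)` is a six-clause pull-back of the `T`-tuple along `m₀` (FILE 1 §3).  §4 the number-field reading:
`A = 𝓞 F`, `K = F`, `T = 𝒪_{F,(w)}`: `t` is a unit of `𝒪_{F,(w)}` for all but finitely many `w` (★ `eventually_isUnit_algebraMap_valuationSubringAtPrime`),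
`(𝓜.localise w).total = 𝓜.total ⊗ 𝒪_{F,(w)}` (★ `localise_total`, `rfl`), and the generic inclusion `((𝓜.localise w).genericIso′)⁻¹ ≫ pr₁` of the
localised model (the P-line՚s `genIncl`) is `𝓜.genericIso⁻¹ ≫ (P ◁ κ_w)` for the tower morphism `κ_w : Spec F → Spec 𝒪_{F,(w)}`
(★ `towerLeftIso_hom_fst∕_snd`).

MAIN STATEMENTS.  §2 `nonempty_hom_specOver_baseDiagram_of_isUnit`, `hom_comp_eq_leg`, `whiskerLeft_left_comp_whiskerLeft_left_eq_leg`;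
§3 **`exists_tupleRel_stage_baseChange_specOver`** (+ `…_symm`; the generic reading along `𝟙`),
**`exists_tupleRel_stage_baseChange_of_tupleRel_comp_whiskerLeft`** (general base map); §4
`eventually_nonempty_hom_specOver_valuationSubringAtPrime_baseDiagram`, `towerLeftIso_hom_comp_whiskerLeft_left`,
`towerLeftIso_inv_comp_fst_eq_whiskerLeft_left`, `IntegralModel.genericIso'_inv_left_comp_fst`.

## References
* [EGAIV3] A. Grothendieck, J. Dieudonné, *EGA* IV₃, Publ. Math. IHÉS 28 (1966), Thm. 8.8.2 and 8.8.2.5.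
* [MumfordFogartyKirwan1994] D. Mumford, J. Fogarty, F. Kirwan, *Geometric Invariant Theory*, 3rd ed. (1994), Ch. 7 §2 Def. 7.2 (p. 129).
* [GortzWedhorn2020] U. Görtz, T. Wedhorn, *Algebraic Geometry I*, 2nd ed. (2020), Section (4.7) (pp. 107–108), Prop. 4.16 (p. 101), §(4.8),
  Cor. 10.64 (2) (p. 329).
* [SerreTate1968] J.-P. Serre, J. Tate, *Good reduction of abelian varieties*, Ann. of Math. 88 (1968), §1.
-/

set_option autoImplicit false

noncomputable section

-- Mathlib's `Over`/pull-back API is stated across semireducible wrappers (as in the ★ `AbelianSchemes/*` and `Limits/*` files).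
set_option backward.isDefEq.respectTransparency false

universe u

open CategoryTheory CategoryTheory.Limits AlgebraicGeometry MonoidalCategory CartesianMonoidalCategory

/-! ### §2 The stage `D(t) = Spec A[1/t]` receives every `A`-algebra `T` with `t ∈ Tˣ`, compatibly with the cone legs -/

namespace Literature.AlgebraicGeometry.AbelianSchemes

open Literature.AlgebraicGeometry.Motives (SchemeOver specOver baseChange)
open Literature.AlgebraicGeometry.Limits.LocApprox (Idx baseDiagram leg hom_eq_of_mono_hom)

section Stage

variable {A : Type u} [CommRing A] (S : Submonoid A) (K : Type u) [CommRing K] [Algebra A K] [IsLocalization S K]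
  (P : SchemeOver A) (t : Idx S) (T : Type u) [CommRing T] [Algebra A T]

/-- **`Spec T → D(t)` over `Spec A` when `t ∈ Tˣ`** ([EGAIV3] 8.8.2.5; [GortzWedhorn2020] Cor. 10.64 (2)): the `A`-algebra map
`A[1∕t] → T` (Mathlib `IsLocalization.Away.lift`) gives an `A`-morphism `Spec T → Spec A[1∕t]` (the pattern of ★
`exists_actionOver_specOver_of_isUnit`). [cite: EGAIV3, Thm. 8.8.2 and 8.8.2.5] [cite: GortzWedhorn2020, Cor. 10.64 (2), p. 329] -/
theorem nonempty_hom_specOver_baseDiagram_of_isUnit (hT : IsUnit (algebraMap A T t.val)) :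
    Nonempty (specOver A T ⟶ (baseDiagram S).obj t) :=
  ⟨Over.homMk (Spec.map (CommRingCat.ofHom (IsLocalization.Away.lift t.val hT))) (by
      change Spec.map _ ≫ Spec.map (CommRingCat.ofHom (algebraMap A (Localization.Away t.val))) =
        Spec.map (CommRingCat.ofHom (algebraMap A T))
      rw [← Spec.map_comp, ← CommRingCat.ofHom_comp, IsLocalization.Away.lift_comp])⟩

/-- **Morphisms into the open stage `D(t)` are unique**: for every `A`-morphism `τ : Spec T → D(t)` and every `A`-morphism `κ : Spec K → Spec T`
(`K = A_S`), `κ ≫ τ` is the cone leg `Spec K → D(t)` (`D(t) ↪ Spec A` is a monomorphism; ★ `hom_eq_of_mono_hom`).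
[cite: GortzWedhorn2020, Cor. 10.64 (2), p. 329] [cite: EGAIV3, Thm. 8.8.2 and 8.8.2.5] -/
theorem hom_comp_eq_leg (τ : specOver A T ⟶ (baseDiagram S).obj t) (κ : specOver A K ⟶ specOver A T) : κ ≫ τ = leg S K t := by
  haveI : Mono ((baseDiagram S).obj t).hom :=
    inferInstanceAs (Mono (Spec.map (CommRingCat.ofHom (algebraMap A (Localization.Away t.val)))))
  exact hom_eq_of_mono_hom _ _ _

/-- **`(P ◁ κ) ≫ (P ◁ τ) = P ◁ leg` on underlying schemes**: the restriction `P ×_A Spec K → P ×_A Spec T → P ×_A D(t)` is the cone map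
`P ×_A Spec K → P ×_A D(t)`. [cite: GortzWedhorn2020, Section (4.7) (pp. 107–108)] -/
theorem whiskerLeft_left_comp_whiskerLeft_left_eq_leg (τ : specOver A T ⟶ (baseDiagram S).obj t) (κ : specOver A K ⟶ specOver A T) :
    (P ◁ κ).left ≫ (P ◁ τ).left = (P ◁ leg S K t).left := by
  rw [← Over.comp_left, ← MonoidalCategory.whiskerLeft_comp, hom_comp_eq_leg S K t T τ κ]

end Stage

end Literature.AlgebraicGeometry.AbelianSchemes

/-! ### §3 THE HEAD: a tuple over the stage `P ⊗ D(t)` restricts to `P ⊗ Spec T` (`t ∈ Tˣ`), with its generic reading along every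
`κ : Spec K → Spec T` -/

namespace Literature.AlgebraicGeometry.AbelianSchemes

namespace AbelianSchemeOver

open Literature.AlgebraicGeometry.Motives (SchemeOver specOver baseChange)
open Literature.AlgebraicGeometry.Limits.LocApprox (Idx baseDiagram leg)

section Head

variable {A : Type u} [CommRing A] (S : Submonoid A) (K : Type u) [CommRing K] [Algebra A K] [IsLocalization S K]
  (P : SchemeOver A) (t : Idx S) (T : Type u) [CommRing T] [Algebra A T]
  (𝒜 : AbelianSchemeOver (P ⊗ (baseDiagram S).obj t).left) {O : Type*} [CommRing O] (ρ : RingAction O 𝒜) (D : 𝒜.DualPair)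
  (pol : 𝒜.Polarization D) {g n : ℕ} (lvl : 𝒜.LevelStructure g n)
  (τ : specOver A T ⟶ (baseDiagram S).obj t) (κ : specOver A K ⟶ specOver A T)

/-- **STAGE TUPLE ⇒ `T`-TUPLE, WITH ITS GENERIC READING** ([EGAIV3] 8.8.2.5 for the moduli datum; [MumfordFogartyKirwan1994] Def. 7.2;
[GortzWedhorn2020] (4.7)).  Let `(𝒜, ι, (Â, 𝒫), λ, φ)` be a PEL tuple over the stage `P ⊗ D(t) = P ×_A Spec A[1∕t]`, `τ : Spec T → D(t)` an
`A`-morphism (it exists iff `t ∈ Tˣ`, `nonempty_hom_specOver_baseDiagram_of_isUnit`) and `κ : Spec K → Spec T` any `A`-morphism (`K = A_S`).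
The `T`-TUPLE is the base change along `P ◁ τ : P ⊗ Spec T → P ⊗ D(t)` (★ `AbelianSchemeOver∕RingAction∕DualPair∕Polarization∕LevelStructure.baseChange`);
its base change to the generic fibre `P ⊗ Spec K` along `P ◁ κ` and the base change of the STAGE tuple along the cone map `P ◁ leg` satisfy
the five clauses of MFK's isomorphism of tuples along `𝟙 (P ⊗ Spec K)` — level ∕ `X`, `X̂`, Poincaré, EXACT `λ` — `𝒪`-equivariantly: some
`H : ((𝒜 ×_{P⊗D(t)} (P ⊗ Spec T)) ×_{P ⊗ Spec T} (P ⊗ Spec K) → 𝒜 ×_{P⊗D(t)} (P ⊗ Spec K)`, `Ĥ` likewise on the duals (both base changes of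
the stage tuple along the EQUAL maps `(P ◁ κ) ≫ (P ◁ τ) = P ◁ leg`; FILE 1 §1).  Hence any five-clause identification of `tuple ×_{P ◁ leg} (P ⊗ Spec K)`
transfers to the `T`-tuple (★ `tupleRel_comp_id_id`). [cite: EGAIV3, Thm. 8.8.2 and 8.8.2.5]
[cite: MumfordFogartyKirwan1994, Ch. 7 §2 Definition 7.2 (p. 129)] [cite: GortzWedhorn2020, Section (4.7) (pp. 107–108) and Cor. 10.64 (2) (p. 329)] -/
theorem exists_tupleRel_stage_baseChange_specOver :
    ∃ (H : ((𝒜.baseChange (P ◁ τ).left).baseChange (P ◁ κ).left).X.left ⟶ (𝒜.baseChange (P ◁ leg S K t).left).X.left)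
      (Ĥ : ((D.baseChange (P ◁ τ).left).baseChange (P ◁ κ).left).hat.X.left ⟶ (D.baseChange (P ◁ leg S K t).left).hat.X.left),
      ((lvl.baseChange (P ◁ τ).left).baseChange (P ◁ κ).left).IsBaseChangeVia (lvl.baseChange (P ◁ leg S K t).left)
          (𝟙 (P ⊗ specOver A K).left) H ∧
      ((D.baseChange (P ◁ τ).left).baseChange (P ◁ κ).left).hat.IsBaseChangeVia (D.baseChange (P ◁ leg S K t).left).hat
          (𝟙 (P ⊗ specOver A K).left) Ĥ ∧
      (∃ (wG : ((𝒜.baseChange (P ◁ τ).left).baseChange (P ◁ κ).left).X.hom ≫ 𝟙 (P ⊗ specOver A K).left =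
            H ≫ (𝒜.baseChange (P ◁ leg S K t).left).X.hom)
          (wĜ : ((D.baseChange (P ◁ τ).left).baseChange (P ◁ κ).left).hat.X.hom ≫ 𝟙 (P ⊗ specOver A K).left =
            Ĥ ≫ (D.baseChange (P ◁ leg S K t).left).hat.X.hom),
        Nonempty ((Scheme.Modules.pullback
          (pullback.map ((𝒜.baseChange (P ◁ τ).left).baseChange (P ◁ κ).left).X.hom
            ((D.baseChange (P ◁ τ).left).baseChange (P ◁ κ).left).hat.X.hom
            (𝒜.baseChange (P ◁ leg S K t).left).X.hom (D.baseChange (P ◁ leg S K t).left).hat.X.hom H Ĥ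
            (𝟙 (P ⊗ specOver A K).left) wG wĜ)).obj (D.baseChange (P ◁ leg S K t).left).P ≅
          ((D.baseChange (P ◁ τ).left).baseChange (P ◁ κ).left).P)) ∧
      ((pol.baseChange (P ◁ τ).left).baseChange (P ◁ κ).left).lam.left ≫ Ĥ = H ≫ (pol.baseChange (P ◁ leg S K t).left).lam.left ∧
      ∀ a : O, (baseChangeHom (baseChangeHom (ρ.i a) (P ◁ τ).left) (P ◁ κ).left).left ≫ H =
        H ≫ (baseChangeHom (ρ.i a) (P ◁ leg S K t).left).left :=
  exists_tupleRel_baseChange_baseChange_of_comp_eq 𝒜 ρ D pol lvl (P ◁ τ).left (P ◁ κ).left (P ◁ leg S K t).left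
    (whiskerLeft_left_comp_whiskerLeft_left_eq_leg S K P t T τ κ)

/-- **The inverse direction of the head**: maps `𝒜 ×_{P⊗D(t)} (P ⊗ Spec K) → ((𝒜 ×_{P⊗D(t)} (P ⊗ Spec T)) ×_{P ⊗ Spec T} (P ⊗ Spec K)` and
the same on the duals, with the five clauses along `𝟙 (P ⊗ Spec K)` and `𝒪`-equivariance — so identifications OF the stage tuple's generic
restriction transfer to the `T`-tuple's by ★ `tupleRel_comp_id_id` in either order. [cite: MumfordFogartyKirwan1994, Ch. 7 §2 Definition 7.2 (p. 129)]
[cite: GortzWedhorn2020, Section (4.7) (pp. 107–108)] [cite: EGAIV3, Thm. 8.8.2 and 8.8.2.5] -/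
theorem exists_tupleRel_stage_baseChange_specOver_symm :
    ∃ (H : (𝒜.baseChange (P ◁ leg S K t).left).X.left ⟶ ((𝒜.baseChange (P ◁ τ).left).baseChange (P ◁ κ).left).X.left)
      (Ĥ : (D.baseChange (P ◁ leg S K t).left).hat.X.left ⟶ ((D.baseChange (P ◁ τ).left).baseChange (P ◁ κ).left).hat.X.left),
      (lvl.baseChange (P ◁ leg S K t).left).IsBaseChangeVia ((lvl.baseChange (P ◁ τ).left).baseChange (P ◁ κ).left)
          (𝟙 (P ⊗ specOver A K).left) H ∧
      (D.baseChange (P ◁ leg S K t).left).hat.IsBaseChangeVia ((D.baseChange (P ◁ τ).left).baseChange (P ◁ κ).left).hat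
          (𝟙 (P ⊗ specOver A K).left) Ĥ ∧
      (∃ (wG : (𝒜.baseChange (P ◁ leg S K t).left).X.hom ≫ 𝟙 (P ⊗ specOver A K).left =
            H ≫ ((𝒜.baseChange (P ◁ τ).left).baseChange (P ◁ κ).left).X.hom)
          (wĜ : (D.baseChange (P ◁ leg S K t).left).hat.X.hom ≫ 𝟙 (P ⊗ specOver A K).left =
            Ĥ ≫ ((D.baseChange (P ◁ τ).left).baseChange (P ◁ κ).left).hat.X.hom),
        Nonempty ((Scheme.Modules.pullback
          (pullback.map (𝒜.baseChange (P ◁ leg S K t).left).X.hom (D.baseChange (P ◁ leg S K t).left).hat.X.hom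
            ((𝒜.baseChange (P ◁ τ).left).baseChange (P ◁ κ).left).X.hom
            ((D.baseChange (P ◁ τ).left).baseChange (P ◁ κ).left).hat.X.hom H Ĥ
            (𝟙 (P ⊗ specOver A K).left) wG wĜ)).obj ((D.baseChange (P ◁ τ).left).baseChange (P ◁ κ).left).P ≅
          (D.baseChange (P ◁ leg S K t).left).P)) ∧
      (pol.baseChange (P ◁ leg S K t).left).lam.left ≫ Ĥ = H ≫ ((pol.baseChange (P ◁ τ).left).baseChange (P ◁ κ).left).lam.left ∧
      ∀ a : O, (baseChangeHom (ρ.i a) (P ◁ leg S K t).left).left ≫ H =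
        H ≫ (baseChangeHom (baseChangeHom (ρ.i a) (P ◁ τ).left) (P ◁ κ).left).left :=
  exists_tupleRel_baseChange_of_comp_eq_baseChange_baseChange 𝒜 ρ D pol lvl (P ◁ τ).left (P ◁ κ).left (P ◁ leg S K t).left
    (whiskerLeft_left_comp_whiskerLeft_left_eq_leg S K P t T τ κ)

/-- **STAGE TUPLE ⇒ `T`-TUPLE, IN THE GENERAL-BASE-MAP CURRENCY** (the form the P-line՚s `gen_iso` provenance consumes through ★
`exists_tupleIsoVia_of_tupleRel`): a tuple `(A_Z, ι_Z, (Â_Z, 𝒫_Z), λ_Z, φ_Z)` over any `Z` (e.g. the E-witness over the generic fibre) that is a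
six-clause pull-back of the STAGE tuple along `m₀ ≫ (P ◁ τ)` for some `m₀ : Z → P ⊗ Spec T` (e.g. `m₀ = 𝓜.genericIso⁻¹ ≫ (P ◁ κ)`, the generic
inclusion of the localised model, §4, with `(P ◁ κ) ≫ (P ◁ τ) = P ◁ leg`, §2) IS a six-clause pull-back of the `T`-TUPLE (the base change along
`P ◁ τ`) along `m₀`. [cite: EGAIV3, Thm. 8.8.2 and 8.8.2.5] [cite: MumfordFogartyKirwan1994, Ch. 7 §2 Definition 7.2 (p. 129)]
[cite: GortzWedhorn2020, Prop. 4.16 (p. 101) and Section (4.7) (pp. 107–108)] -/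
theorem exists_tupleRel_stage_baseChange_of_tupleRel_comp_whiskerLeft {Z : Scheme.{u}} (m₀ : Z ⟶ (P ⊗ specOver A T).left)
    {𝒜Z : AbelianSchemeOver Z} {DZ : 𝒜Z.DualPair} {lamZ : 𝒜Z.X ⟶ DZ.hat.X} {φZ : 𝒜Z.LevelStructure g n}
    {actZ : O → (𝒜Z.X ⟶ 𝒜Z.X)} {G : 𝒜Z.X.left ⟶ 𝒜.X.left} {Ĝ : DZ.hat.X.left ⟶ D.hat.X.left}
    (h : φZ.IsBaseChangeVia lvl (m₀ ≫ (P ◁ τ).left) G ∧ DZ.hat.IsBaseChangeVia D.hat (m₀ ≫ (P ◁ τ).left) Ĝ ∧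
      (∃ (wG : 𝒜Z.X.hom ≫ m₀ ≫ (P ◁ τ).left = G ≫ 𝒜.X.hom) (wĜ : DZ.hat.X.hom ≫ m₀ ≫ (P ◁ τ).left = Ĝ ≫ D.hat.X.hom),
        Nonempty ((Scheme.Modules.pullback
          (pullback.map 𝒜Z.X.hom DZ.hat.X.hom 𝒜.X.hom D.hat.X.hom G Ĝ (m₀ ≫ (P ◁ τ).left) wG wĜ)).obj D.P ≅ DZ.P)) ∧
      lamZ.left ≫ Ĝ = G ≫ pol.lam.left ∧ ∀ a : O, (actZ a).left ≫ G = G ≫ (ρ.i a).left) :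
    ∃ (G' : 𝒜Z.X.left ⟶ (𝒜.baseChange (P ◁ τ).left).X.left) (Ĝ' : DZ.hat.X.left ⟶ (D.baseChange (P ◁ τ).left).hat.X.left),
      G' ≫ pullback.fst 𝒜.X.hom (P ◁ τ).left = G ∧ Ĝ' ≫ pullback.fst D.hat.X.hom (P ◁ τ).left = Ĝ ∧
      (φZ.IsBaseChangeVia (lvl.baseChange (P ◁ τ).left) m₀ G' ∧ DZ.hat.IsBaseChangeVia (D.baseChange (P ◁ τ).left).hat m₀ Ĝ' ∧
        (∃ (wG : 𝒜Z.X.hom ≫ m₀ = G' ≫ (𝒜.baseChange (P ◁ τ).left).X.hom)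
            (wĜ : DZ.hat.X.hom ≫ m₀ = Ĝ' ≫ (D.baseChange (P ◁ τ).left).hat.X.hom),
          Nonempty ((Scheme.Modules.pullback
            (pullback.map 𝒜Z.X.hom DZ.hat.X.hom (𝒜.baseChange (P ◁ τ).left).X.hom (D.baseChange (P ◁ τ).left).hat.X.hom G' Ĝ' m₀
              wG wĜ)).obj (D.baseChange (P ◁ τ).left).P ≅ DZ.P)) ∧
        lamZ.left ≫ Ĝ' = G' ≫ (pol.baseChange (P ◁ τ).left).lam.left ∧
        ∀ a : O, (actZ a).left ≫ G' = G' ≫ (baseChangeHom (ρ.i a) (P ◁ τ).left).left) :=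
  exists_tupleRel_baseChange_of_tupleRel_comp 𝒜 ρ D pol lvl (P ◁ τ).left m₀ h

end Head

end AbelianSchemeOver

end Literature.AlgebraicGeometry.AbelianSchemes

/-! ### §4 Number fields: the stage is reached by `𝒪_{F,(w)}` for almost all `w`; the generic inclusion of the localised model -/

namespace Literature.AlgebraicGeometry.AbelianSchemes

open Literature.AlgebraicGeometry.Motives IsDedekindDomain
open Literature.AlgebraicGeometry.Limits.LocApprox (Idx baseDiagram leg)
open scoped NumberField

section Tower

variable {A R K : Type} [CommRing A] [CommRing R] [Field K] [Algebra A R] [Algebra R K] [Algebra A K] [IsScalarTower A R K]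
  (P : SchemeOver A)

/-- **`towerLeftIso ≫ (P ◁ κ) = pr₁`**: for the tower `A → R → K` and the tower morphism `κ : Spec K → Spec R` over `Spec A`, the composite
`(P ⊗_A R) ⊗_R K ≅ P ⊗_A K → P ⊗_A R` is the first projection (both have the same projections to `P` and to `Spec R`; ★
`towerLeftIso_hom_fst∕_snd`, Mathlib `Over.whiskerLeft_left_fst∕_snd` — the computation inside ★ `baseChange_map_comp_towerIsoOver_hom_of_whiskerLeft`,
named). [cite: GortzWedhorn2020, Prop. 4.16 and §(4.8)] -/
theorem towerLeftIso_hom_comp_whiskerLeft_left (κ : specOver A K ⟶ specOver A R)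
    (hκ : κ.left = Spec.map (CommRingCat.ofHom (algebraMap R K))) :
    (IntegralModel.towerLeftIso (R := R) (K := K) P).hom ≫ (P ◁ κ).left =
      pullback.fst (pullback.snd P.hom (Spec.map (CommRingCat.ofHom (algebraMap A R)))) (Spec.map (CommRingCat.ofHom (algebraMap R K))) := by
  have i1 : (P ◁ κ).left ≫ pullback.fst P.hom (Spec.map (CommRingCat.ofHom (algebraMap A R))) =
      pullback.fst P.hom (Spec.map (CommRingCat.ofHom (algebraMap A K))) :=
    Over.whiskerLeft_left_fst κ
  have i2 : (P ◁ κ).left ≫ pullback.snd P.hom (Spec.map (CommRingCat.ofHom (algebraMap A R))) =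
      pullback.snd P.hom (Spec.map (CommRingCat.ofHom (algebraMap A K))) ≫ κ.left :=
    Over.whiskerLeft_left_snd κ
  apply pullback.hom_ext
  · rw [Category.assoc]
    erw [i1]
    rw [IntegralModel.towerLeftIso_hom_fst]
    rfl
  · rw [Category.assoc]
    erw [i2]
    rw [IntegralModel.towerLeftIso_hom_snd_assoc, hκ]
    exact pullback.condition.symm

/-- **The generic inclusion in the cartesian-monoidal currency**: `towerLeftIso⁻¹ ≫ pr₁ : P ⊗_A K ≅ (P ⊗_A R) ⊗_R K → P ⊗_A R` is `(P ◁ κ).left`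
for the tower morphism `κ : Spec K → Spec R`. [cite: GortzWedhorn2020, Prop. 4.16 and §(4.8)] -/
theorem towerLeftIso_inv_comp_fst_eq_whiskerLeft_left (κ : specOver A K ⟶ specOver A R)
    (hκ : κ.left = Spec.map (CommRingCat.ofHom (algebraMap R K))) :
    (IntegralModel.towerLeftIso (R := R) (K := K) P).inv ≫
        pullback.fst (pullback.snd P.hom (Spec.map (CommRingCat.ofHom (algebraMap A R)))) (Spec.map (CommRingCat.ofHom (algebraMap R K))) =
      (P ◁ κ).left := by
  rw [Iso.inv_comp_eq, towerLeftIso_hom_comp_whiskerLeft_left P κ hκ]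

end Tower

section NumberField

variable {F : Type} [Field F] [NumberField F] {X : SchemeOver F}

/-- **Almost every `w` reaches the stage `D(t)`**: for a non-zero-divisor index `t` of `𝓞 F`, for all but finitely many primes `w` there is
an `𝓞 F`-morphism `Spec 𝒪_{F,(w)} → D(t)` (`t ∈ 𝒪_{F,(w)}ˣ` for almost all `w`, ★ `eventually_isUnit_algebraMap_valuationSubringAtPrime`; then
`nonempty_hom_specOver_baseDiagram_of_isUnit`). [cite: EGAIV3, Thm. 8.8.2 and 8.8.2.5] [cite: SerreTate1968, §1] -/
theorem eventually_nonempty_hom_specOver_valuationSubringAtPrime_baseDiagram (t : Idx (nonZeroDivisors (𝓞 F))) :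
    ∀ᶠ w : HeightOneSpectrum (𝓞 F) in Filter.cofinite,
      Nonempty (specOver (𝓞 F) (HeightOneSpectrum.valuationSubringAtPrime F w) ⟶ (baseDiagram (nonZeroDivisors (𝓞 F))).obj t) := by
  filter_upwards [Literature.RingTheory.DedekindDomain.eventually_isUnit_algebraMap_valuationSubringAtPrime (K := F)
    (nonZeroDivisors.ne_zero t.mem)] with w hT
  exact nonempty_hom_specOver_baseDiagram_of_isUnit (nonZeroDivisors (𝓞 F)) t (HeightOneSpectrum.valuationSubringAtPrime F w) hT

/-- **The generic inclusion of the localised model `𝓜.localise w`** (the P-line's `genIncl`, `((𝓜.localise w).genericIso′)⁻¹ ≫ pr₁`): with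
`(𝓜.localise w).total = 𝓜.total ⊗_{𝓞 F} 𝒪_{F,(w)}` (★ `localise_total`, `rfl`) and `genericIso′ = towerIsoOver ≪≫ 𝓜.genericIso` (`rfl`), it is
`𝓜.genericIso⁻¹ ≫ (𝓜.total ◁ κ_w)` for the tower morphism `κ_w : Spec F → Spec 𝒪_{F,(w)}` over `Spec 𝓞 F`.
[cite: SerreTate1968, §1] [cite: GortzWedhorn2020, Prop. 4.16 and §(4.8)] -/
theorem _root_.Literature.AlgebraicGeometry.Motives.IntegralModel.genericIso'_inv_left_comp_fst (𝓜 : IntegralModel (𝓞 F) F X) (w : HeightOneSpectrum (𝓞 F))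
    (κ : specOver (𝓞 F) F ⟶ specOver (𝓞 F) (HeightOneSpectrum.valuationSubringAtPrime F w))
    (hκ : κ.left = Spec.map (CommRingCat.ofHom (algebraMap (HeightOneSpectrum.valuationSubringAtPrime F w) F))) :
    (𝓜.localise w).genericIso'.inv.left ≫
        pullback.fst (𝓜.localise w).total.hom
          (Spec.map (CommRingCat.ofHom (algebraMap (HeightOneSpectrum.valuationSubringAtPrime F w) F))) =
      𝓜.genericIso.inv.left ≫ (𝓜.total ◁ κ).left := by
  have h1 : (𝓜.localise w).genericIso'.inv.left =
      𝓜.genericIso.inv.left ≫ (IntegralModel.towerLeftIso (R := HeightOneSpectrum.valuationSubringAtPrime F w) (K := F) 𝓜.total).inv :=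
    rfl
  rw [h1, Category.assoc]
  erw [towerLeftIso_inv_comp_fst_eq_whiskerLeft_left 𝓜.total κ hκ]

end NumberField

end Literature.AlgebraicGeometry.AbelianSchemes

end
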